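import Summits.KontsevichZagierPeriods.KontsevichZagierPeriods.Theorems.FermatIsogenyDeepWordSectorBP5

/-! # `FermatIsogenyDeepWordSectorBP6` — part 6/7 of the mechanical ≤400-line split of `B_src.lean` (sha256 9cb321caf3c881c0…)
Source: decomp-kz lens-5 g22 DeepWordSectorB.lean v4 @d2f1e37a (levels 3/4 closed hypothesis-free, Dirichlet move proved, level 6 from the linear rung; critic CLEARED g7-5 l.1397 / g7-7 l.1406); --supports stmt-KontsevichZagierPeriods-3898.
Split by census-1 g10 `gen/splitlean.py`: scopes re-opened with their `open`/`variable`/`set_option` context; mathematics and declaration order unchanged. -/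

noncomputable section
namespace Summit.KontsevichZagierPeriods.FermatIsogeny.DeepTargets
open Literature.NumberTheory.Transcendental MeasureTheory
open Summit.KontsevichZagierPeriods.KontsevichZagierPeriods.Theses.FermatIsogeny (BetaLinearSector BetaProductSector FermatSectorComplete)
open Literature.NumberTheory.Transcendental MeasureTheory in
open Summit.KontsevichZagierPeriods.KontsevichZagierPeriods.Theses.FermatIsogeny (BetaLinearSector BetaProductSector FermatSectorComplete) in
/-- Auxiliary step `sqrt_three_pos`: sqrt three pos. [bookkeeping] -/
private theorem sqrt_three_pos : 0 < Real.sqrt 3 := Real.sqrt_pos.mpr (by norm_num)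

open Literature.NumberTheory.Transcendental MeasureTheory in
open Summit.KontsevichZagierPeriods.KontsevichZagierPeriods.Theses.FermatIsogeny (BetaLinearSector BetaProductSector FermatSectorComplete) in
/-- Auxiliary step `isAlgebraic_sqrt_three`: is Algebraic sqrt three. [bookkeeping] -/
private theorem isAlgebraic_sqrt_three : IsAlgebraic ℚ (Real.sqrt 3) := by simpa using isAlgebraic_sqrt_nat 3

open Literature.NumberTheory.Transcendental MeasureTheory in
open Summit.KontsevichZagierPeriods.KontsevichZagierPeriods.Theses.FermatIsogeny (BetaLinearSector BetaProductSector FermatSectorComplete) in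
/-- Rational numbers are real algebraic. [bookkeeping] -/
private theorem isAlgebraic_ratCast (x : ℚ) : IsAlgebraic ℚ (x : ℝ) := by
  have h := isAlgebraic_algebraMap (R := ℚ) (A := ℝ) x; rwa [eq_ratCast] at h

open Literature.NumberTheory.Transcendental MeasureTheory in
open Summit.KontsevichZagierPeriods.KontsevichZagierPeriods.Theses.FermatIsogeny (BetaLinearSector BetaProductSector FermatSectorComplete) in
/-- Auxiliary step `isAlgebraic_two`: is Algebraic two. [bookkeeping] -/
private theorem isAlgebraic_two : IsAlgebraic ℚ (2:ℝ) := by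
  simpa using isAlgebraic_ratCast 2

section LevelSixChains

/-- `Γ(⅓)Γ(⅔)√3 = 2π`. [folklore: Euler reflection] -/
theorem Gamma_third_twoThirds_sqrt3 : Real.Gamma ((1:ℝ)/3) * Real.Gamma ((2:ℝ)/3) * Real.sqrt 3 = 2 * Real.pi := by
  rw [Gamma_two_thirds]; have hG : Real.Gamma ((1:ℝ)/3) ≠ 0 := (Real.Gamma_pos_of_pos (by norm_num)).ne'
  have h3 : Real.sqrt 3 ≠ 0 := by positivity
  field_simp

/-- `Γ(½)² = π`. [folklore] -/
theorem Gamma_half_mul_self : Real.Gamma ((1:ℝ)/2) * Real.Gamma ((1:ℝ)/2) = Real.pi := by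
  rw [Real.Gamma_one_half_eq, Real.mul_self_sqrt Real.pi_pos.le]

/-- Legendre at `⅙`: `Γ(⅙)Γ(⅔) = Γ(⅓)·W²·Γ(½)`. [folklore: duplication formula] -/
theorem Gamma_sixth_twoThirds : Real.Gamma ((1:ℝ)/6) * Real.Gamma ((2:ℝ)/3) = Real.Gamma ((1:ℝ)/3) * cW ^ 2 * Real.Gamma ((1:ℝ)/2) := by
  have hd := Real.Gamma_mul_Gamma_add_half ((1:ℝ)/6)
  rw [show (1:ℝ)/6 + 1/2 = 2/3 by norm_num, show (2:ℝ) * (1/6) = 1/3 by norm_num,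
    show (1:ℝ) - 1/3 = 2/3 by norm_num] at hd
  rw [hd, cW_sq, Real.Gamma_one_half_eq]

/-- Legendre at `⅓`: `Γ(⅓)Γ(⅚) = Γ(⅔)·W·Γ(½)`. [folklore: duplication formula] -/
theorem Gamma_third_fiveSixths : Real.Gamma ((1:ℝ)/3) * Real.Gamma ((5:ℝ)/6) = Real.Gamma ((2:ℝ)/3) * cW * Real.Gamma ((1:ℝ)/2) := by
  have hd := Real.Gamma_mul_Gamma_add_half ((1:ℝ)/3)
  rw [show (1:ℝ)/3 + 1/2 = 5/6 by norm_num, show (2:ℝ) * (1/3) = 2/3 by norm_num,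
    show (1:ℝ) - 2/3 = 1/3 by norm_num] at hd
  rw [hd, cW, Real.Gamma_one_half_eq]

/-- Auxiliary step `frac_eq_aux`: frac eq aux. [bookkeeping] -/
theorem frac_eq_aux {a b c d e : ℝ} (hb : b ≠ 0) (he : e ≠ 0) (h : a * e = c * d * b) : a / b = c * (d / e) := by
  rw [← mul_div_assoc, div_eq_div_iff hb he]; exact h

/-- Auxiliary step `Gamma_sixth_ne_zero`: Gamma sixth ne zero. [bookkeeping] -/
theorem Gamma_sixth_ne_zero : Real.Gamma ((1:ℝ)/6) ≠ 0 := (Real.Gamma_pos_of_pos (by norm_num)).ne'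
/-- Auxiliary step `Gamma_third_ne_zero`: Gamma third ne zero. [bookkeeping] -/
theorem Gamma_third_ne_zero : Real.Gamma ((1:ℝ)/3) ≠ 0 := (Real.Gamma_pos_of_pos (by norm_num)).ne'
/-- Auxiliary step `Gamma_half_ne_zero`: Gamma half ne zero. [bookkeeping] -/
theorem Gamma_half_ne_zero : Real.Gamma ((1:ℝ)/2) ≠ 0 := (Real.Gamma_pos_of_pos (by norm_num)).ne'
/-- Auxiliary step `Gamma_twoThirds_ne_zero`: Gamma two Thirds ne zero. [bookkeeping] -/
theorem Gamma_twoThirds_ne_zero : Real.Gamma ((2:ℝ)/3) ≠ 0 := (Real.Gamma_pos_of_pos (by norm_num)).ne'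
/-- Auxiliary step `Gamma_fiveSixths_ne_zero`: Gamma five Sixths ne zero. [bookkeeping] -/
theorem Gamma_fiveSixths_ne_zero : Real.Gamma ((5:ℝ)/6) ≠ 0 := (Real.Gamma_pos_of_pos (by norm_num)).ne'
/-- Auxiliary step `Gamma_sevenSixths_ne_zero`: Gamma seven Sixths ne zero. [bookkeeping] -/
theorem Gamma_sevenSixths_ne_zero : Real.Gamma ((7:ℝ)/6) ≠ 0 := (Real.Gamma_pos_of_pos (by norm_num)).ne'

/-- Auxiliary step `Gamma_seven_sixths`: Gamma seven sixths. [bookkeeping] -/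
theorem Gamma_seven_sixths : Real.Gamma ((7:ℝ)/6) = 1/6 * Real.Gamma ((1:ℝ)/6) := by
  rw [show (7:ℝ)/6 = 1/6 + 1 by norm_num, Real.Gamma_add_one (by norm_num)]
/-- Auxiliary step `Gamma_four_thirds`: Gamma four thirds. [bookkeeping] -/
theorem Gamma_four_thirds : Real.Gamma ((4:ℝ)/3) = 1/3 * Real.Gamma ((1:ℝ)/3) := by
  rw [show (4:ℝ)/3 = 1/3 + 1 by norm_num, Real.Gamma_add_one (by norm_num)]
/-- Auxiliary step `Gamma_three_halves`: Gamma three halves. [bookkeeping] -/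
theorem Gamma_three_halves : Real.Gamma ((3:ℝ)/2) = 1/2 * Real.Gamma ((1:ℝ)/2) := by
  rw [show (3:ℝ)/2 = 1/2 + 1 by norm_num, Real.Gamma_add_one (by norm_num)]
/-- Auxiliary step `Gamma_five_thirds`: Gamma five thirds. [bookkeeping] -/
theorem Gamma_five_thirds : Real.Gamma ((5:ℝ)/3) = 2/3 * Real.Gamma ((2:ℝ)/3) := by
  rw [show (5:ℝ)/3 = 2/3 + 1 by norm_num, Real.Gamma_add_one (by norm_num)]

/-! #### the twelve value identities `B(i/6,j/6) = q·B(canonical)`, canonical cells `A = B(⅓,½)`, `C = B(⅔,½)`, `X = B(½,½)` -/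

/-- Auxiliary step `gammaSix_11`: gamma Six 11. [bookkeeping] -/
theorem gammaSix_11 : Real.Gamma ((1:ℝ)/6) * Real.Gamma ((1:ℝ)/6) / Real.Gamma ((1:ℝ)/3)
    = (Real.sqrt 3 * cW ^ 2) * (Real.Gamma ((1:ℝ)/3) * Real.Gamma ((1:ℝ)/2) / Real.Gamma ((5:ℝ)/6)) :=
  frac_eq_aux Gamma_third_ne_zero Gamma_fiveSixths_ne_zero (by
    linear_combination Real.Gamma ((1:ℝ)/6) * Gamma_one_sixth_mul_Gamma_five_sixths
      - Real.Gamma ((1:ℝ)/6) * Gamma_third_twoThirds_sqrt3 + (Real.sqrt 3 * Real.Gamma ((1:ℝ)/3)) * Gamma_sixth_twoThirds)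

/-- Auxiliary step `gammaSix_12`: gamma Six 12. [bookkeeping] -/
theorem gammaSix_12 : Real.Gamma ((1:ℝ)/6) * Real.Gamma ((1:ℝ)/3) / Real.Gamma ((1:ℝ)/2)
    = 2 * (Real.Gamma ((1:ℝ)/3) * Real.Gamma ((1:ℝ)/2) / Real.Gamma ((5:ℝ)/6)) :=
  frac_eq_aux Gamma_half_ne_zero Gamma_fiveSixths_ne_zero (by
    linear_combination Real.Gamma ((1:ℝ)/3) * Gamma_one_sixth_mul_Gamma_five_sixths
      - (2 * Real.Gamma ((1:ℝ)/3)) * Gamma_half_mul_self)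

/-- Auxiliary step `gammaSix_13`: gamma Six 13. [bookkeeping] -/
theorem gammaSix_13 : Real.Gamma ((1:ℝ)/6) * Real.Gamma ((1:ℝ)/2) / Real.Gamma ((2:ℝ)/3)
    = Real.sqrt 3 * (Real.Gamma ((1:ℝ)/3) * Real.Gamma ((1:ℝ)/2) / Real.Gamma ((5:ℝ)/6)) :=
  frac_eq_aux Gamma_twoThirds_ne_zero Gamma_fiveSixths_ne_zero (by
    linear_combination Real.Gamma ((1:ℝ)/2) * Gamma_one_sixth_mul_Gamma_five_sixths
      - Real.Gamma ((1:ℝ)/2) * Gamma_third_twoThirds_sqrt3)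

/-- Auxiliary step `gammaSix_14`: gamma Six 14. [bookkeeping] -/
theorem gammaSix_14 : Real.Gamma ((1:ℝ)/6) * Real.Gamma ((2:ℝ)/3) / Real.Gamma ((5:ℝ)/6)
    = cW ^ 2 * (Real.Gamma ((1:ℝ)/3) * Real.Gamma ((1:ℝ)/2) / Real.Gamma ((5:ℝ)/6)) :=
  frac_eq_aux Gamma_fiveSixths_ne_zero Gamma_fiveSixths_ne_zero (by
    linear_combination Real.Gamma ((5:ℝ)/6) * Gamma_sixth_twoThirds)

/-- Auxiliary step `gammaSix_15`: gamma Six 15. [bookkeeping] -/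
theorem gammaSix_15 : Real.Gamma ((1:ℝ)/6) * Real.Gamma ((5:ℝ)/6) / Real.Gamma 1
    = 2 * (Real.Gamma ((1:ℝ)/2) * Real.Gamma ((1:ℝ)/2) / Real.Gamma 1) := by
  rw [Real.Gamma_one]
  exact frac_eq_aux one_ne_zero one_ne_zero (by
    linear_combination Gamma_one_sixth_mul_Gamma_five_sixths - 2 * Gamma_half_mul_self)

/-- Auxiliary step `gammaSix_22`: gamma Six 22. [bookkeeping] -/
theorem gammaSix_22 : Real.Gamma ((1:ℝ)/3) * Real.Gamma ((1:ℝ)/3) / Real.Gamma ((2:ℝ)/3)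
    = cW * (Real.Gamma ((1:ℝ)/3) * Real.Gamma ((1:ℝ)/2) / Real.Gamma ((5:ℝ)/6)) :=
  frac_eq_aux Gamma_twoThirds_ne_zero Gamma_fiveSixths_ne_zero (by
    linear_combination Real.Gamma ((1:ℝ)/3) * Gamma_third_fiveSixths)

/-- Auxiliary step `gammaSix_24`: gamma Six 24. [bookkeeping] -/
theorem gammaSix_24 : Real.Gamma ((1:ℝ)/3) * Real.Gamma ((2:ℝ)/3) / Real.Gamma 1
    = (2/3 * Real.sqrt 3) * (Real.Gamma ((1:ℝ)/2) * Real.Gamma ((1:ℝ)/2) / Real.Gamma 1) := by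
  have hr3 : Real.sqrt 3 * Real.sqrt 3 = 3 := Real.mul_self_sqrt (by norm_num)
  rw [Real.Gamma_one]
  exact frac_eq_aux one_ne_zero one_ne_zero (by
    linear_combination (Real.sqrt 3 / 3) * Gamma_third_twoThirds_sqrt3
      - (Real.Gamma ((1:ℝ)/3) * Real.Gamma ((2:ℝ)/3) / 3) * hr3 - (2/3 * Real.sqrt 3) * Gamma_half_mul_self)

/-- Auxiliary step `gammaSix_25`: gamma Six 25. [bookkeeping] -/
theorem gammaSix_25 : Real.Gamma ((1:ℝ)/3) * Real.Gamma ((5:ℝ)/6) / Real.Gamma ((7:ℝ)/6)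
    = cW * (Real.Gamma ((2:ℝ)/3) * Real.Gamma ((1:ℝ)/2) / Real.Gamma ((7:ℝ)/6)) :=
  frac_eq_aux Gamma_sevenSixths_ne_zero Gamma_sevenSixths_ne_zero (by
    linear_combination Real.Gamma ((7:ℝ)/6) * Gamma_third_fiveSixths)

/-- Auxiliary step `gammaSix_35`: gamma Six 35. [bookkeeping] -/
theorem gammaSix_35 : Real.Gamma ((1:ℝ)/2) * Real.Gamma ((5:ℝ)/6) / Real.Gamma ((4:ℝ)/3)
    = (1/2 * Real.sqrt 3) * (Real.Gamma ((2:ℝ)/3) * Real.Gamma ((1:ℝ)/2) / Real.Gamma ((7:ℝ)/6)) := by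
  rw [Gamma_four_thirds, Gamma_seven_sixths]
  exact frac_eq_aux (mul_ne_zero (by norm_num) Gamma_third_ne_zero) (mul_ne_zero (by norm_num) Gamma_sixth_ne_zero) (by
    linear_combination (Real.Gamma ((1:ℝ)/2) / 6) * Gamma_one_sixth_mul_Gamma_five_sixths
      - (Real.Gamma ((1:ℝ)/2) / 6) * Gamma_third_twoThirds_sqrt3)

/-- Auxiliary step `gammaSix_44`: gamma Six 44. [bookkeeping] -/
theorem gammaSix_44 : Real.Gamma ((2:ℝ)/3) * Real.Gamma ((2:ℝ)/3) / Real.Gamma ((4:ℝ)/3)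
    = (1/2 * cW ^ 2) * (Real.Gamma ((2:ℝ)/3) * Real.Gamma ((1:ℝ)/2) / Real.Gamma ((7:ℝ)/6)) := by
  rw [Gamma_four_thirds, Gamma_seven_sixths]
  exact frac_eq_aux (mul_ne_zero (by norm_num) Gamma_third_ne_zero) (mul_ne_zero (by norm_num) Gamma_sixth_ne_zero) (by
    linear_combination (Real.Gamma ((2:ℝ)/3) / 6) * Gamma_sixth_twoThirds)

/-- Auxiliary step `gammaSix_45`: gamma Six 45. [bookkeeping] -/
theorem gammaSix_45 : Real.Gamma ((2:ℝ)/3) * Real.Gamma ((5:ℝ)/6) / Real.Gamma ((3:ℝ)/2)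
    = (2/3 : ℝ) * (Real.Gamma ((2:ℝ)/3) * Real.Gamma ((1:ℝ)/2) / Real.Gamma ((7:ℝ)/6)) := by
  rw [Gamma_three_halves, Gamma_seven_sixths]
  exact frac_eq_aux (mul_ne_zero (by norm_num) Gamma_half_ne_zero) (mul_ne_zero (by norm_num) Gamma_sixth_ne_zero) (by
    linear_combination (Real.Gamma ((2:ℝ)/3) / 6) * Gamma_one_sixth_mul_Gamma_five_sixths
      - (Real.Gamma ((2:ℝ)/3) / 3) * Gamma_half_mul_self)

/-- Auxiliary step `gammaSix_55`: gamma Six 55. [bookkeeping] -/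
theorem gammaSix_55 : Real.Gamma ((5:ℝ)/6) * Real.Gamma ((5:ℝ)/6) / Real.Gamma ((5:ℝ)/3)
    = (1/4 * Real.sqrt 3 * cW) * (Real.Gamma ((2:ℝ)/3) * Real.Gamma ((1:ℝ)/2) / Real.Gamma ((7:ℝ)/6)) := by
  rw [Gamma_five_thirds, Gamma_seven_sixths]
  exact frac_eq_aux (mul_ne_zero (by norm_num) Gamma_twoThirds_ne_zero) (mul_ne_zero (by norm_num) Gamma_sixth_ne_zero) (by
    linear_combination (Real.Gamma ((5:ℝ)/6) / 6) * Gamma_one_sixth_mul_Gamma_five_sixths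
      - (Real.Gamma ((5:ℝ)/6) / 6) * Gamma_third_twoThirds_sqrt3
      + (Real.sqrt 3 * Real.Gamma ((2:ℝ)/3) / 6) * Gamma_third_fiveSixths)

/-- `bval a b` as a Γ-quotient at prescribed real arguments. [bookkeeping] -/
theorem bval_eq' {a b : ℚ} (ha : 0 < a) (hb : 0 < b) {x y z : ℝ} (hx : (a:ℝ) = x) (hy : (b:ℝ) = y) (hz : x + y = z) :
    bval a b = Real.Gamma x * Real.Gamma y / Real.Gamma z := by
  rw [bval_eq ha hb, hx, hy, hz]

/-! #### the thirty-six level-6 letters in `P` (modulo the linear rung) -/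

/-- Auxiliary step `bcl_sixth_one`: bcl sixth one. [bookkeeping] -/
theorem bcl_sixth_one : bcl (1/6) 1 = kcQ 6 := by
  rw [bcl_rat_one (1/6) (by norm_num), kcQ]; exact kc_congr _ _ (by norm_num)
/-- Auxiliary step `bcl_one_sixth`: bcl one sixth. [bookkeeping] -/
theorem bcl_one_sixth : bcl 1 (1/6) = kcQ 6 := by
  rw [bcl_symm betaReflectionMove_holds 1 (1/6) (by norm_num) (by norm_num), bcl_sixth_one]
/-- Auxiliary step `bcl_fiveSixths_one`: bcl five Sixths one. [bookkeeping] -/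
theorem bcl_fiveSixths_one : bcl (5/6) 1 = kcQ (6/5) := by
  rw [bcl_rat_one (5/6) (by norm_num), kcQ]; exact kc_congr _ _ (by norm_num)
/-- Auxiliary step `bcl_one_fiveSixths`: bcl one five Sixths. [bookkeeping] -/
theorem bcl_one_fiveSixths : bcl 1 (5/6) = kcQ (6/5) := by
  rw [bcl_symm betaReflectionMove_holds 1 (5/6) (by norm_num) (by norm_num), bcl_fiveSixths_one]
/-- Auxiliary step `bcl_half_twoThirds`: bcl half two Thirds. [bookkeeping] -/
theorem bcl_half_twoThirds : bcl (1/2) (2/3) = bcl (2/3) (1/2) :=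
  bcl_symm betaReflectionMove_holds (1/2) (2/3) (by norm_num) (by norm_num)
/-- Auxiliary step `bcl_half_third`: bcl half third. [bookkeeping] -/
theorem bcl_half_third : bcl (1/2) (1/3) = bcl (1/3) (1/2) :=
  bcl_symm betaReflectionMove_holds (1/2) (1/3) (by norm_num) (by norm_num)

/-- `β(⅙,⅙) = κ(√3)κ(W)²·A`. [this node, from the linear rung] -/
theorem bcl6_11 (h6 : BetaLinearSixths) : bcl (1/6) (1/6) = kcR * kcW ^ 2 * bcl (1/3) (1/2) := by
  rw [bcl_eq_kc_mul_of_linear h6 (a := 1/6) (b := 1/6) (a' := 1/3) (b' := 1/2) (by norm_num) (by norm_num) (by norm_num) (by norm_num) ⟨1, by norm_num⟩ ⟨1, by norm_num⟩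
    ⟨2, by norm_num⟩ ⟨3, by norm_num⟩ (isAlgebraic_sqrt_three.mul (isAlgebraic_cW.pow 2))
    (by rw [bval_eq' (a := 1/6) (b := 1/6) (x := 1/6) (y := 1/6) (z := 1/3) (by norm_num) (by norm_num)
          (by norm_num) (by norm_num) (by norm_num),
          bval_eq' (a := 1/3) (b := 1/2) (x := 1/3) (y := 1/2) (z := 5/6) (by norm_num) (by norm_num)
          (by norm_num) (by norm_num) (by norm_num)]
        exact gammaSix_11)]
  rw [kcR, kcW, kc_pow, ← kc_mul]

/-- `β(⅙,⅓) = κ(2)·A`. [this node, from the linear rung] -/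
theorem bcl6_12 (h6 : BetaLinearSixths) : bcl (1/6) (1/3) = kcQ 2 * bcl (1/3) (1/2) := by
  rw [bcl_eq_kc_mul_of_linear h6 (a := 1/6) (b := 1/3) (a' := 1/3) (b' := 1/2) (by norm_num) (by norm_num) (by norm_num) (by norm_num) ⟨1, by norm_num⟩ ⟨2, by norm_num⟩
    ⟨2, by norm_num⟩ ⟨3, by norm_num⟩ isAlgebraic_two
    (by rw [bval_eq' (a := 1/6) (b := 1/3) (x := 1/6) (y := 1/3) (z := 1/2) (by norm_num) (by norm_num)
          (by norm_num) (by norm_num) (by norm_num),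
          bval_eq' (a := 1/3) (b := 1/2) (x := 1/3) (y := 1/2) (z := 5/6) (by norm_num) (by norm_num)
          (by norm_num) (by norm_num) (by norm_num)]
        exact gammaSix_12)]
  have hk : kc (2:ℝ) isAlgebraic_two = kcQ 2 := by rw [kcQ]; refine kc_congr _ _ ?_; norm_num
  rw [hk]

/-- Auxiliary step `bcl6_21`: bcl6 21. [bookkeeping] -/
theorem bcl6_21 (h6 : BetaLinearSixths) : bcl (1/3) (1/6) = kcQ 2 * bcl (1/3) (1/2) := by
  rw [bcl_symm betaReflectionMove_holds (1/3) (1/6) (by norm_num) (by norm_num), bcl6_12 h6]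

/-- `β(⅙,½) = κ(√3)·A` — the CM `3`-isogeny coincidence. [this node, from the linear rung] -/
theorem bcl6_13 (h6 : BetaLinearSixths) : bcl (1/6) (1/2) = kcR * bcl (1/3) (1/2) := by
  rw [bcl_eq_kc_mul_of_linear h6 (a := 1/6) (b := 1/2) (a' := 1/3) (b' := 1/2) (by norm_num) (by norm_num) (by norm_num) (by norm_num) ⟨1, by norm_num⟩ ⟨3, by norm_num⟩
    ⟨2, by norm_num⟩ ⟨3, by norm_num⟩ isAlgebraic_sqrt_three
    (by rw [bval_eq' (a := 1/6) (b := 1/2) (x := 1/6) (y := 1/2) (z := 2/3) (by norm_num) (by norm_num)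
          (by norm_num) (by norm_num) (by norm_num),
          bval_eq' (a := 1/3) (b := 1/2) (x := 1/3) (y := 1/2) (z := 5/6) (by norm_num) (by norm_num)
          (by norm_num) (by norm_num) (by norm_num)]
        exact gammaSix_13)]
  rfl

/-- Auxiliary step `bcl6_31`: bcl6 31. [bookkeeping] -/
theorem bcl6_31 (h6 : BetaLinearSixths) : bcl (1/2) (1/6) = kcR * bcl (1/3) (1/2) := by
  rw [bcl_symm betaReflectionMove_holds (1/2) (1/6) (by norm_num) (by norm_num), bcl6_13 h6]

/-- `β(⅙,⅔) = κ(W)²·A`. [this node, from the linear rung] -/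
theorem bcl6_14 (h6 : BetaLinearSixths) : bcl (1/6) (2/3) = kcW ^ 2 * bcl (1/3) (1/2) := by
  rw [bcl_eq_kc_mul_of_linear h6 (a := 1/6) (b := 2/3) (a' := 1/3) (b' := 1/2) (by norm_num) (by norm_num) (by norm_num) (by norm_num) ⟨1, by norm_num⟩ ⟨4, by norm_num⟩
    ⟨2, by norm_num⟩ ⟨3, by norm_num⟩ (isAlgebraic_cW.pow 2)
    (by rw [bval_eq' (a := 1/6) (b := 2/3) (x := 1/6) (y := 2/3) (z := 5/6) (by norm_num) (by norm_num)
          (by norm_num) (by norm_num) (by norm_num),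
          bval_eq' (a := 1/3) (b := 1/2) (x := 1/3) (y := 1/2) (z := 5/6) (by norm_num) (by norm_num)
          (by norm_num) (by norm_num) (by norm_num)]
        exact gammaSix_14)]
  rw [kcW, kc_pow]

/-- Auxiliary step `bcl6_41`: bcl6 41. [bookkeeping] -/
theorem bcl6_41 (h6 : BetaLinearSixths) : bcl (2/3) (1/6) = kcW ^ 2 * bcl (1/3) (1/2) := by
  rw [bcl_symm betaReflectionMove_holds (2/3) (1/6) (by norm_num) (by norm_num), bcl6_14 h6]

/-- `β(⅙,⅚) = κ(2)·X` — Euler reflection at `⅙`. [this node, from the linear rung] -/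
theorem bcl6_15 (h6 : BetaLinearSixths) : bcl (1/6) (5/6) = kcQ 2 * bcl (1/2) (1/2) := by
  rw [bcl_eq_kc_mul_of_linear h6 (a := 1/6) (b := 5/6) (a' := 1/2) (b' := 1/2) (by norm_num) (by norm_num) (by norm_num) (by norm_num) ⟨1, by norm_num⟩ ⟨5, by norm_num⟩
    ⟨3, by norm_num⟩ ⟨3, by norm_num⟩ isAlgebraic_two
    (by rw [bval_eq' (a := 1/6) (b := 5/6) (x := 1/6) (y := 5/6) (z := 1) (by norm_num) (by norm_num)
          (by norm_num) (by norm_num) (by norm_num),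
          bval_eq' (a := 1/2) (b := 1/2) (x := 1/2) (y := 1/2) (z := 1) (by norm_num) (by norm_num)
          (by norm_num) (by norm_num) (by norm_num)]
        exact gammaSix_15)]
  have hk : kc (2:ℝ) isAlgebraic_two = kcQ 2 := by rw [kcQ]; refine kc_congr _ _ ?_; norm_num
  rw [hk]

/-- Auxiliary step `bcl6_51`: bcl6 51. [bookkeeping] -/
theorem bcl6_51 (h6 : BetaLinearSixths) : bcl (5/6) (1/6) = kcQ 2 * bcl (1/2) (1/2) := by
  rw [bcl_symm betaReflectionMove_holds (5/6) (1/6) (by norm_num) (by norm_num), bcl6_15 h6]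

/-- `β(⅓,⅓) = κ(W)·A` — Legendre at `⅓`. [this node, from the linear rung] -/
theorem bcl6_22 (h6 : BetaLinearSixths) : bcl (1/3) (1/3) = kcW * bcl (1/3) (1/2) := by
  rw [bcl_eq_kc_mul_of_linear h6 (a := 1/3) (b := 1/3) (a' := 1/3) (b' := 1/2) (by norm_num) (by norm_num) (by norm_num) (by norm_num) ⟨2, by norm_num⟩ ⟨2, by norm_num⟩
    ⟨2, by norm_num⟩ ⟨3, by norm_num⟩ isAlgebraic_cW
    (by rw [bval_eq' (a := 1/3) (b := 1/3) (x := 1/3) (y := 1/3) (z := 2/3) (by norm_num) (by norm_num)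
          (by norm_num) (by norm_num) (by norm_num),
          bval_eq' (a := 1/3) (b := 1/2) (x := 1/3) (y := 1/2) (z := 5/6) (by norm_num) (by norm_num)
          (by norm_num) (by norm_num) (by norm_num)]
        exact gammaSix_22)]
  rfl

/-- `β(⅓,⅔) = κ(2/3)κ(√3)·X` — Euler reflection at `⅓`. [this node, from the linear rung] -/
theorem bcl6_24 (h6 : BetaLinearSixths) : bcl (1/3) (2/3) = kcQ (2/3) * kcR * bcl (1/2) (1/2) := by
  rw [bcl_eq_kc_mul_of_linear h6 (a := 1/3) (b := 2/3) (a' := 1/2) (b' := 1/2) (by norm_num) (by norm_num) (by norm_num) (by norm_num) ⟨2, by norm_num⟩ ⟨4, by norm_num⟩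
    ⟨3, by norm_num⟩ ⟨3, by norm_num⟩ ((isAlgebraic_ratCast (2/3 : ℚ)).mul isAlgebraic_sqrt_three)
    (by rw [bval_eq' (a := 1/3) (b := 2/3) (x := 1/3) (y := 2/3) (z := 1) (by norm_num) (by norm_num)
          (by norm_num) (by norm_num) (by norm_num),
          bval_eq' (a := 1/2) (b := 1/2) (x := 1/2) (y := 1/2) (z := 1) (by norm_num) (by norm_num)
          (by norm_num) (by norm_num) (by norm_num)]
        push_cast
        exact gammaSix_24)]
  rw [kcQ, kcR, ← kc_mul]
/-- Auxiliary step `bcl6_42`: bcl6 42. [bookkeeping] -/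
theorem bcl6_42 (h6 : BetaLinearSixths) : bcl (2/3) (1/3) = kcQ (2/3) * kcR * bcl (1/2) (1/2) := by
  rw [bcl_symm betaReflectionMove_holds (2/3) (1/3) (by norm_num) (by norm_num), bcl6_24 h6]
/-- `β(⅓,⅚) = κ(W)·C`. [this node, from the linear rung] -/
theorem bcl6_25 (h6 : BetaLinearSixths) : bcl (1/3) (5/6) = kcW * bcl (2/3) (1/2) := by
  rw [bcl_eq_kc_mul_of_linear h6 (a := 1/3) (b := 5/6) (a' := 2/3) (b' := 1/2) (by norm_num) (by norm_num) (by norm_num) (by norm_num) ⟨2, by norm_num⟩ ⟨5, by norm_num⟩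
    ⟨4, by norm_num⟩ ⟨3, by norm_num⟩ isAlgebraic_cW
    (by rw [bval_eq' (a := 1/3) (b := 5/6) (x := 1/3) (y := 5/6) (z := 7/6) (by norm_num) (by norm_num)
          (by norm_num) (by norm_num) (by norm_num),
          bval_eq' (a := 2/3) (b := 1/2) (x := 2/3) (y := 1/2) (z := 7/6) (by norm_num) (by norm_num)
          (by norm_num) (by norm_num) (by norm_num)]
        exact gammaSix_25)]
  rfl
/-- Auxiliary step `bcl6_52`: bcl6 52. [bookkeeping] -/
theorem bcl6_52 (h6 : BetaLinearSixths) : bcl (5/6) (1/3) = kcW * bcl (2/3) (1/2) := by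
  rw [bcl_symm betaReflectionMove_holds (5/6) (1/3) (by norm_num) (by norm_num), bcl6_25 h6]
/-- `β(½,⅚) = κ(½)κ(√3)·C`. [this node, from the linear rung] -/
theorem bcl6_35 (h6 : BetaLinearSixths) : bcl (1/2) (5/6) = kcQ (1/2) * kcR * bcl (2/3) (1/2) := by
  rw [bcl_eq_kc_mul_of_linear h6 (a := 1/2) (b := 5/6) (a' := 2/3) (b' := 1/2) (by norm_num) (by norm_num) (by norm_num) (by norm_num) ⟨3, by norm_num⟩ ⟨5, by norm_num⟩
    ⟨4, by norm_num⟩ ⟨3, by norm_num⟩ ((isAlgebraic_ratCast (1/2 : ℚ)).mul isAlgebraic_sqrt_three)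
    (by rw [bval_eq' (a := 1/2) (b := 5/6) (x := 1/2) (y := 5/6) (z := 4/3) (by norm_num) (by norm_num)
          (by norm_num) (by norm_num) (by norm_num),
          bval_eq' (a := 2/3) (b := 1/2) (x := 2/3) (y := 1/2) (z := 7/6) (by norm_num) (by norm_num)
          (by norm_num) (by norm_num) (by norm_num)]
        push_cast
        exact gammaSix_35)]
  rw [kcQ, kcR, ← kc_mul]
/-- Auxiliary step `bcl6_53`: bcl6 53. [bookkeeping] -/
theorem bcl6_53 (h6 : BetaLinearSixths) : bcl (5/6) (1/2) = kcQ (1/2) * kcR * bcl (2/3) (1/2) := by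
  rw [bcl_symm betaReflectionMove_holds (5/6) (1/2) (by norm_num) (by norm_num), bcl6_35 h6]
/-- `β(⅔,⅔) = κ(½)κ(W)²·C` — Legendre at `⅔`. [this node, from the linear rung] -/
theorem bcl6_44 (h6 : BetaLinearSixths) : bcl (2/3) (2/3) = kcQ (1/2) * kcW ^ 2 * bcl (2/3) (1/2) := by
  rw [bcl_eq_kc_mul_of_linear h6 (a := 2/3) (b := 2/3) (a' := 2/3) (b' := 1/2) (by norm_num) (by norm_num) (by norm_num) (by norm_num) ⟨4, by norm_num⟩ ⟨4, by norm_num⟩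
    ⟨4, by norm_num⟩ ⟨3, by norm_num⟩ ((isAlgebraic_ratCast (1/2 : ℚ)).mul (isAlgebraic_cW.pow 2))
    (by rw [bval_eq' (a := 2/3) (b := 2/3) (x := 2/3) (y := 2/3) (z := 4/3) (by norm_num) (by norm_num)
          (by norm_num) (by norm_num) (by norm_num),
          bval_eq' (a := 2/3) (b := 1/2) (x := 2/3) (y := 1/2) (z := 7/6) (by norm_num) (by norm_num)
          (by norm_num) (by norm_num) (by norm_num)]
        push_cast
        exact gammaSix_44)]
  rw [kcQ, kcW, kc_pow, ← kc_mul]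
/-- `β(⅔,⅚) = κ(2/3)·C`. [this node, from the linear rung] -/
theorem bcl6_45 (h6 : BetaLinearSixths) : bcl (2/3) (5/6) = kcQ (2/3) * bcl (2/3) (1/2) := by
  rw [bcl_eq_kc_mul_of_linear h6 (a := 2/3) (b := 5/6) (a' := 2/3) (b' := 1/2) (by norm_num) (by norm_num) (by norm_num) (by norm_num) ⟨4, by norm_num⟩ ⟨5, by norm_num⟩
    ⟨4, by norm_num⟩ ⟨3, by norm_num⟩ (isAlgebraic_ratCast (2/3 : ℚ))
    (by rw [bval_eq' (a := 2/3) (b := 5/6) (x := 2/3) (y := 5/6) (z := 3/2) (by norm_num) (by norm_num)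
          (by norm_num) (by norm_num) (by norm_num),
          bval_eq' (a := 2/3) (b := 1/2) (x := 2/3) (y := 1/2) (z := 7/6) (by norm_num) (by norm_num)
          (by norm_num) (by norm_num) (by norm_num)]
        push_cast
        exact gammaSix_45)]
  rfl
/-- Auxiliary step `bcl6_54`: bcl6 54. [bookkeeping] -/
theorem bcl6_54 (h6 : BetaLinearSixths) : bcl (5/6) (2/3) = kcQ (2/3) * bcl (2/3) (1/2) := by
  rw [bcl_symm betaReflectionMove_holds (5/6) (2/3) (by norm_num) (by norm_num), bcl6_45 h6]
/-- `β(⅚,⅚) = κ(¼)κ(√3)κ(W)·C` — Legendre at `⅚`. [this node, from the linear rung] -/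
theorem bcl6_55 (h6 : BetaLinearSixths) : bcl (5/6) (5/6) = kcQ (1/4) * kcR * kcW * bcl (2/3) (1/2) := by
  rw [bcl_eq_kc_mul_of_linear h6 (a := 5/6) (b := 5/6) (a' := 2/3) (b' := 1/2) (by norm_num) (by norm_num) (by norm_num) (by norm_num) ⟨5, by norm_num⟩ ⟨5, by norm_num⟩
    ⟨4, by norm_num⟩ ⟨3, by norm_num⟩ (((isAlgebraic_ratCast (1/4 : ℚ)).mul isAlgebraic_sqrt_three).mul isAlgebraic_cW)
    (by rw [bval_eq' (a := 5/6) (b := 5/6) (x := 5/6) (y := 5/6) (z := 5/3) (by norm_num) (by norm_num)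
          (by norm_num) (by norm_num) (by norm_num),
          bval_eq' (a := 2/3) (b := 1/2) (x := 2/3) (y := 1/2) (z := 7/6) (by norm_num) (by norm_num)
          (by norm_num) (by norm_num) (by norm_num)]
        push_cast
        exact gammaSix_55)]
  rw [kcQ, kcR, kcW, ← kc_mul, ← kc_mul]
/-- **The level-6 relation in `P`**: `A·C = κ(2√3)·X` — Dirichlet at `(⅙,½,½)`, the unit letter `β(⅙,1) = κ(6)` and the CM letter
`β(⅙,½) = κ(√3)·A`. [this node] -/
theorem relation_six (h6 : BetaLinearSixths) : bcl (1/3) (1/2) * bcl (2/3) (1/2) = kcT6 * bcl (1/2) (1/2) := by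
  have h := bcl_dirichlet (1/6) (1/2) (1/2) (by norm_num) (by norm_num) (by norm_num)
  rw [show (1/6:ℚ) + 1/2 = 2/3 by norm_num, show (1/2:ℚ) + 1/2 = 1 by norm_num, bcl_sixth_one, bcl6_13 h6] at h
  have hR0 : Real.sqrt 3 ≠ 0 := sqrt_three_pos.ne'
  have hRi : kc (Real.sqrt 3)⁻¹ isAlgebraic_sqrt_three.inv * kcR = 1 := by
    rw [mul_comm]; exact kc_mul_kc_inv _ hR0
  have hk : kc (Real.sqrt 3)⁻¹ isAlgebraic_sqrt_three.inv * kcQ 6 = kcT6 := by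
    rw [kcQ, kcT6, ← kc_mul]; refine kc_congr _ _ ?_; have h3 : Real.sqrt 3 * Real.sqrt 3 = 3 := Real.mul_self_sqrt (by norm_num)
    push_cast; rw [inv_mul_eq_div, div_eq_iff hR0]; linear_combination (-2:ℝ) * h3
  calc bcl (1/3) (1/2) * bcl (2/3) (1/2)
        = (kc (Real.sqrt 3)⁻¹ isAlgebraic_sqrt_three.inv * kcR) * (bcl (1/3) (1/2) * bcl (2/3) (1/2)) := by rw [hRi, one_mul]
    _ = kc (Real.sqrt 3)⁻¹ isAlgebraic_sqrt_three.inv * (bcl (2/3) (1/2) * (kcR * bcl (1/3) (1/2))) := by ring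
    _ = kc (Real.sqrt 3)⁻¹ isAlgebraic_sqrt_three.inv * (bcl (1/2) (1/2) * kcQ 6) := by rw [h]
    _ = (kc (Real.sqrt 3)⁻¹ isAlgebraic_sqrt_three.inv * kcQ 6) * bcl (1/2) (1/2) := by ring
    _ = kcT6 * bcl (1/2) (1/2) := by rw [hk]
/-- … and on values: `B(⅓,½)·B(⅔,½) = 2√3·B(½,½)` (`= 2√3·π`). [this node] -/
theorem relation_six_values (h6 : BetaLinearSixths) :
    bval (1/3) (1/2) * bval (2/3) (1/2) = (2 * Real.sqrt 3) * bval (1/2) (1/2) := by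
  have h := congrArg KZ.evalP (relation_six h6); rw [map_mul, map_mul, evalP_kcT6] at h; exact h

/-! #### letter tables -/

end LevelSixChains
end Summit.KontsevichZagierPeriods.FermatIsogeny.DeepTargets
end
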